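import Literature.NumberTheory.QuadraticFields.AmbiguousClasses
import Literature.NumberTheory.NumberFields.ClassGroupCoprimeGaloisDescentCongruence
import HarnessLib

/-!
# Gauss's genus count in RANK currency: `rank₂ Cl(K) = ω(|d_K|) − 1` for an imaginary quadratic field `K`

Topic `NumberTheory/QuadraticFields` (namespace `Literature.NumberTheory.QuadraticFields.Quadratic`, that of `AmbiguousClasses.lean`).  THEOREM-ONLY
file (no definition, no named fact, no `sorry`), written by the prover seat `bsd-line-att-p3` g29 (cell `bsd-f1-sign2`, route `AlignedTransportAtTwo`, crux C2
stmt-BirchSwinnertonDyer-22298: the resolvent `ℚ(√Δ_W)`, `Δ_W < 0`, of the sextic carrier `ℚ(W[2])`; closes nothing; BSD is proved for no curve here).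

The tree's `card_sq_eq_one_classGroup` (Gauss, Cox Prop. 3.11 / Thm. 3.15: `#{C ∈ Cl_K : C² = 1} = 2^{t−1}`, `t = ω(|d_K|)` the number of prime divisors of the
discriminant) is restated in the `2`-RANK currency of the Iwasawa-theory files (`rank₂ M = v₂ #(M/M²)`, tree `IwasawaTheory.classGroupPRank`,
`NumberFields.natCard_torsion_eq_pow_padicValNat_card_quotient`: `#M[2] = 2^{rank₂ M}`):

* `padicValNat_two_card_quotient_sq_eq_card_primeFactors_discr_sub_one` — **`rank₂ Cl(K) = ω(|d_K|) − 1`** for `K` imaginary quadratic;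
* `padicValNat_two_card_quotient_sq_mod_two` — its parity form.

References: [Cox2013] D. A. Cox, *Primes of the form x² + ny²*, 2nd ed. (2013), §3.B Prop. 3.11, Thm. 3.15; tree `QuadraticFields/AmbiguousClasses.lean`.
-/

noncomputable section

open scoped NumberField
open NumberField

namespace Literature.NumberTheory.QuadraticFields.Quadratic

open Literature.NumberTheory.EllipticCurves Literature.NumberTheory.NumberFields

variable {K : Type} [Field K] [NumberField K]

/-- **Gauss's genus count in rank currency: `rank₂ Cl(K) = ω(|d_K|) − 1`** for an imaginary quadratic field `K` (`rank₂ M = v₂ #(M/M²)`; `#Cl_K[2] = 2^{rank₂}`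
and `#Cl_K[2] = 2^{t−1}`, tree `card_sq_eq_one_classGroup`). [cite: Cox2013, §3.B Prop. 3.11 and Thm. 3.15] -/
theorem padicValNat_two_card_quotient_sq_eq_card_primeFactors_discr_sub_one (hK : IsImaginaryQuadratic K) :
    padicValNat 2 (Nat.card (ClassGroup (𝓞 K) ⧸ (powMonoidHom 2 : ClassGroup (𝓞 K) →* _).range)) =
      (NumberField.discr K).natAbs.primeFactors.card - 1 := by
  haveI : Fact (Nat.Prime 2) := ⟨Nat.prime_two⟩
  have h1 := natCard_torsion_eq_pow_padicValNat_card_quotient (M := ClassGroup (𝓞 K)) 2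
  rw [card_sq_eq_one_classGroup hK] at h1
  exact (Nat.pow_right_injective le_rfl h1).symm

/-- Parity form: **`rank₂ Cl(K) ≡ ω(|d_K|) − 1 (mod 2)`** for `K` imaginary quadratic. [cite: Cox2013, §3.B Prop. 3.11 and Thm. 3.15] -/
theorem padicValNat_two_card_quotient_sq_mod_two (hK : IsImaginaryQuadratic K) :
    padicValNat 2 (Nat.card (ClassGroup (𝓞 K) ⧸ (powMonoidHom 2 : ClassGroup (𝓞 K) →* _).range)) % 2 =
      ((NumberField.discr K).natAbs.primeFactors.card - 1) % 2 := by
  rw [padicValNat_two_card_quotient_sq_eq_card_primeFactors_discr_sub_one hK]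

end Literature.NumberTheory.QuadraticFields.Quadratic

end
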